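import Summits.QuantumAdvantage.AdviceFreeQNC0.FacetReduction
import Summits.QuantumAdvantage.AdviceFreeQNC0.DominationSeven
import HarnessLib

/-!
# Cell qa-qnc0 (rung F-Q1, density axis): the WEIGHTED MASS INEQUALITY AT m = 8
# (`weightedMIEight : WeightedMIEight`, planner qa-qnc0-p1 ROUND-12 §2.10 (xi-ab), `MassInequalityK.lean` v6
# §Facet; statements in `FacetReduction.lean`)

DOMINATION IS NORM-AGNOSTIC: a disjoint domination certificate for `K0` (`DisjointDom m K0`: every inside row is
the `xor` of its own private set of outside rows, for every column deviation with codeword columns) bounds the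
inside mass by the outside mass for EVERY row norm `distTo S` with `S ∋ 0` closed under `xor`
(`sum_distTo_inside_le`, the proof of `domPays` verbatim with `S` abstract).  With `S = C_n` (`distC n`):
`massIneqExtAt_of_disjointDom : DisjointDom m K0 → MassIneqExtAt m n K0` for every `n` — so MI(7; C_n) holds at
`Dom7.K0 = [2 ≤ |u| ≤ 5]` for every external cube (`massIneqExtAt_seven`).

THE FACETS OF THE 8-CUBE: the restriction of a SYMMETRIC word to a facet `{u_i = false}` is symmetric
(`isSymPat_facetRestrict_false`), and a symmetric word on the 7-cube with exactly `16 = 1+7+7+1` zeros IS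
`Dom7.K0` (`Dom7.eq_K0_of_isSymPat`: the only sub-multiset of the binomials `1,7,21,35,35,21,7,1` summing to 16
is `{C(7,0),C(7,1),C(7,6),C(7,7)}` — a `decide +kernel` over the 256 weight profiles); optimality in `C_7` forces
exactly 16 zeros (`Dom7.isOpt1_K0` both ways).  Hence **`weightedMIEight : WeightedMIEight`**: for a symmetric
`K0` on the 8-cube whose false-facets are optimal for `C_7`, and every `D` with columns in `C_8`,
`0 ≤ Σ_i bracketExt 7 8 (K0|{u_i=0}) (D|{u_i=0})` — the `(8 − |u|)`-weighted mass inequality at `m = 8`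
(facet columns are codewords of `C_7` by `facetCode 7`).

WHAT THIS IS NOT: the unweighted MI(8) (`MassIneqAt 8`) and `MassIneqAll` are OPEN; nothing on α;
separation NOT moved.
-/

namespace Summit.QuantumAdvantage.AdviceFreeQNC0

open Finset
open Literature.Computability.MetaComplexity Literature.Computability.MetaComplexity.Smolensky

namespace MassInequality

/-! ### Domination is norm-agnostic -/

/-- **Inside mass ≤ outside mass** under a disjoint domination certificate, for EVERY row norm `distTo S`
with `0 ∈ S` and `S` closed under `xor`, and every deviation with codeword columns (the proof of `domPays`,
`S` abstract). -/
theorem sum_distTo_inside_le {m N : ℕ} {K0 : (Fin m → Bool) → Bool} (hdom : DisjointDom m K0)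
    {S : ((Fin N → Bool) → Bool) → Prop} (h0 : S (fun _ => false))
    (hxor : ∀ Q Q', S Q → S Q' → S (fun v => xor (Q v) (Q' v)))
    (D : (Fin m → Bool) → (Fin N → Bool) → Bool) (hD : ∀ v, IsElim1 m (fun u => D u v)) :
    ∑ z ∈ univ.filter (fun u : Fin m → Bool => K0 u = false), distTo S (D z) ≤
      ∑ u ∈ univ.filter (fun u : Fin m → Bool => K0 u = true), distTo S (D u) := by
  classical
  obtain ⟨R, hR, hdisj⟩ := hdom
  set Z := univ.filter (fun u : Fin m → Bool => K0 u = false) with hZ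
  set O := univ.filter (fun u : Fin m → Bool => K0 u = true) with hO
  -- inside rows are xor-folds of outside rows
  have hrow : ∀ z ∈ Z, D z = xorFold (R z) D := by
    intro z hz
    have hz' : K0 z = false := (mem_filter.1 hz).2
    funext v
    have hiff := (hR z hz').2 (fun u => D u v) (hD v)
    unfold xorFold
    by_cases h : D z v = true
    · rw [h]; exact (Bool.decide_iff _).2 (hiff.1 h) |>.symm
    · rw [Bool.not_eq_true] at h
      rw [h]
      symm
      rw [decide_eq_false_iff_not]
      intro hodd
      rw [hiff.2 hodd] at h
      exact Bool.noConfusion h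
  calc ∑ z ∈ Z, distTo S (D z) ≤ ∑ z ∈ Z, ∑ u ∈ R z, distTo S (D u) := by
        refine sum_le_sum fun z hz => ?_
        rw [hrow z hz]
        exact distTo_xorFold_le h0 hxor (R z) D
    _ = ∑ u ∈ Z.biUnion R, distTo S (D u) := by
        rw [sum_biUnion]
        intro z hz z' hz' hne
        exact hdisj z z' (mem_filter.1 hz).2 (mem_filter.1 hz').2 hne
    _ ≤ ∑ u ∈ O, distTo S (D u) := by
        refine sum_le_sum_of_subset_of_nonneg (fun u hu => ?_) (fun _ _ _ => Nat.zero_le _)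
        rw [mem_biUnion] at hu
        obtain ⟨z, hz, huz⟩ := hu
        exact mem_filter.2 ⟨mem_univ _, (hR z (mem_filter.1 hz).2).1 u huz⟩

/-- `distC n` is `distTo C_n`. -/
theorem distC_eq_distTo' (n : ℕ) (r : (Fin n → Bool) → Bool) : distC n r = distTo (IsElim1 n) r := rfl

/-- **MI(m; C_n) from domination**: a disjoint domination certificate for `K0` gives `MassIneqExtAt m n K0` for
EVERY external cube `n`. -/
theorem massIneqExtAt_of_disjointDom {m : ℕ} {K0 : (Fin m → Bool) → Bool} (hdom : DisjointDom m K0) (n : ℕ) :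
    MassIneqExtAt m n K0 := by
  intro D hD
  have hle := sum_distTo_inside_le hdom (isElim1_false n) (fun Q Q' hQ hQ' => isElim1_xor hQ hQ') D hD
  unfold bracketExt
  simp only [distC_eq_distTo']
  have hcast : ((∑ z ∈ univ.filter (fun u : Fin m → Bool => K0 u = false), distTo (IsElim1 n) (D z) : ℕ) : ℤ) ≤
      ((∑ u ∈ univ.filter (fun u : Fin m → Bool => K0 u = true), distTo (IsElim1 n) (D u) : ℕ) : ℤ) := by
    exact_mod_cast hle
  push_cast at hcast
  linarith

namespace Dom7

/-- The disjoint domination certificate of `Dom7.K0` (from `DominationSeven.lean`). -/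
theorem disjointDom_K0 : DisjointDom 7 K0 :=
  ⟨R, fun z hz => ⟨(sets_check.1 z hz).1, fun _ hA => rel_holds hz hA⟩,
    fun z z' hz hz' hne => Disjoint.mono (subset_insert _ _) (subset_insert _ _) (sets_check.2 z z' hz hz' hne)⟩

/-- Hence MI(7; C_n) at `Dom7.K0` for every external cube `n`. -/
theorem massIneqExtAt_seven (n : ℕ) : MassIneqExtAt 7 n K0 := massIneqExtAt_of_disjointDom disjointDom_K0 n

/-! ### A symmetric word on the 7-cube with 16 zeros is `Dom7.K0` -/

/-- The standard vector of weight `j`: the first `j` coordinates set. -/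
def stdVec (j : Fin 8) : Fin 7 → Bool := fun p => decide (p.val < j.val)

/-- `|stdVec j| = j`. -/
theorem wt_stdVec : ∀ j : Fin 8, wt (stdVec j) = j.val := by
  unfold wt stdVec; decide

/-- The binomial count (finite check over the 256 weight profiles): a weight profile with exactly 16 zeros on
the 7-cube is the profile of `K0` (`16 = C(7,0)+C(7,1)+C(7,6)+C(7,7)` is the only solution). -/
theorem profile_check : ∀ g : Fin 8 → Bool,
    (univ.filter fun u : Fin 7 → Bool => g ⟨wt u % 8, Nat.mod_lt _ (by norm_num)⟩ = false).card = 16 →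
      g = fun j => decide (2 ≤ j.val ∧ j.val ≤ 5) := by
  unfold wt
  decide +kernel

/-- **A symmetric word on the 7-cube with exactly 16 zeros is `K0 = [2 ≤ |u| ≤ 5]`.** -/
theorem eq_K0_of_isSymPat {K : (Fin 7 → Bool) → Bool} (hsym : IsSymPat K) (h16 : failCount K = 16) :
    K = K0 := by
  have hlt : ∀ u : Fin 7 → Bool, wt u < 8 := fun u => by
    have : wt u ≤ 7 := by unfold wt; exact (card_le_univ _).trans (by simp)
    omega
  have hmod : ∀ u : Fin 7 → Bool, wt u % 8 = wt u := fun u => Nat.mod_eq_of_lt (hlt u)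
  -- the weight profile of `K`
  set g : Fin 8 → Bool := fun j => K (stdVec j) with hg
  have hK : ∀ u, K u = g ⟨wt u % 8, Nat.mod_lt _ (by norm_num)⟩ := fun u => by
    rw [hg]
    exact hsym u _ (by rw [wt_stdVec]; exact (hmod u).symm)
  have hcount : (univ.filter fun u : Fin 7 → Bool => g ⟨wt u % 8, Nat.mod_lt _ (by norm_num)⟩ = false).card = 16 := by
    rw [← h16]
    unfold failCount
    exact congrArg Finset.card (filter_congr fun u _ => by rw [hK u])
  have hprof := profile_check g hcount
  funext u
  rw [hK u, hprof]
  unfold K0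
  simp only [hmod u]

end Dom7

/-! ### The facets of a symmetric word -/

/-- The restriction of a symmetric word to a facet `{u_i = false}` is symmetric. -/
theorem isSymPat_facetRestrict_false {m : ℕ} {K0 : (Fin (m + 1) → Bool) → Bool} (hsym : IsSymPat K0)
    (i : Fin (m + 1)) : IsSymPat (facetRestrict i false K0) := by
  intro u v huv
  unfold facetRestrict
  apply hsym
  rw [wt_insertNth, wt_insertNth, huv]

/-- An OPTIMAL word of `C_7` has exactly `16` zeros (`Dom7.isOpt1_K0` both ways). -/
theorem failCount_eq_of_isOpt1_seven {K : (Fin 7 → Bool) → Bool} (hK : IsOpt1 7 K) : failCount K = 16 := by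
  have h1 := hK.2 Dom7.K0 Dom7.isElim1_K0
  have h2 := Dom7.isOpt1_K0.2 K hK.1
  rw [Dom7.failCount_K0] at h1 h2
  omega

/-- **`WeightedMIEight` — PROVED**: the `(8 − |u|)`-weighted mass inequality at `m = 8` for every deviation with
codeword columns, at every symmetric `K0` whose false-facets are optimal for `C_7`. -/
theorem weightedMIEight : WeightedMIEight := by
  intro K0 _ hsym hfac D hcols
  refine sum_nonneg fun i _ => ?_
  have hEq : facetRestrict i false K0 = Dom7.K0 :=
    Dom7.eq_K0_of_isSymPat (isSymPat_facetRestrict_false hsym i) (failCount_eq_of_isOpt1_seven (hfac i))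
  rw [hEq]
  exact Dom7.massIneqExtAt_seven 8 _ fun v => facetCode 7 (fun u => D u v) (hcols v) i false

end MassInequality

end Summit.QuantumAdvantage.AdviceFreeQNC0
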